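import Literature.RingTheory.MvPolynomial.MacaulayLexSegments
import Mathlib.Tactic.Push
import HarnessLib

/-!
# Macaulay's theorem on lex segments, II: compression; the theorem for arbitrary families

The `(i,j)`-compression (`i < j`) of a family `A ⊆ Mon_d`: on every line
`{k - t·e_i + t·e_j : 0 ≤ t ≤ k_i}` (representative `k = ckey i j b`, position `t = b_j`), replace
the members of `A` by equally many points with the smallest `x_j`-exponents (`compress`). It keeps
`|A|` (`card_compress`), does not increase the upper shadow (`card_shadow_compress_le`, a
line-by-line comparison of position sets), and strictly lowers the potential `Σ_{a ∈ A} Σ_l l·a_l`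
when `A` is not `(i,j)`-compressed (`potential_compress_lt`); a family compressed for all `i < j`
is Borel. Hence every family can be replaced by a Borel set of the same size with no larger shadow
(`exists_isBorel_card_eq`) and, with Part I, **Macaulay's theorem** (`card_shadow_le_of_isLexSeg`):
a lex segment has the least upper shadow among all families of degree-`d` monomials of at least its
size — Miller–Sturmfels Thm. 2.22, there via generic initial ideals in characteristic `0`; the
compression route is the multiset analogue of Erdős–Ko–Rado / Kruskal–Katona shifting, purely
combinatorial and therefore valid over every field once leading monomials are taken (Part III).

## References

* [MillerSturmfels2005] E. Miller, B. Sturmfels, *Combinatorial Commutative Algebra*, GTM 227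
  (2005), §2.4, Thm. 2.22.
-/

namespace Literature.RingTheory.MvPolynomial.Macaulay

open Finset

variable {n : ℕ}

/-! ## Compression of an arbitrary family to a Borel set

For `i < j` the `(i,j)`-compression of `A ⊆ Mon n d` replaces, on every line
`{k - t e_i + t e_j : t}`, the members of `A` by the same number of points with the smallest
`x_j`-exponents. It preserves the cardinality, does not increase the upper shadow, and strictly
decreases the potential `Σ_{a ∈ A} Σ_l l·a_l` unless `A` is already `(i,j)`-compressed; a family
compressed for all `i < j` is Borel. (Folklore; the multiset analogue of Erdős–Ko–Rado shifting.) -/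

section Compression

variable {i j : Fin n}

/-- Coordinates of a multiple of a unit vector. [folklore] -/
theorem smul_e_apply (t : ℕ) (i l : Fin n) : (t • e i) l = if l = i then t else 0 := by
  simp [e_apply]

/-- The representative of the `(i,j)`-line through `b`: all of the `x_j`-exponent moved onto `x_i`. [folklore] -/
def ckey (i j : Fin n) (b : Fin n → ℕ) : Fin n → ℕ := b + b j • e i - b j • e j

/-- The point with `x_j`-exponent `t` on the `(i,j)`-line with representative `k`. [folklore] -/
def cpt (i j : Fin n) (k : Fin n → ℕ) (t : ℕ) : Fin n → ℕ := k - t • e i + t • e j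

/-- Coordinates of the line representative `ckey i j b`. [folklore] -/
theorem ckey_apply (hij : i ≠ j) (b : Fin n → ℕ) (l : Fin n) :
    ckey i j b l = if l = j then 0 else if l = i then b i + b j else b l := by
  simp only [ckey, Pi.add_apply, Pi.sub_apply, smul_e_apply]
  by_cases hlj : l = j
  · subst hlj; simp [hij.symm]
  · by_cases hli : l = i
    · subst hli; simp [hij]
    · simp [hlj, hli]

/-- Coordinates of the line point `cpt i j k t`. [folklore] -/
theorem cpt_apply (hij : i ≠ j) (k : Fin n → ℕ) (t : ℕ) (l : Fin n) :
    cpt i j k t l = if l = j then k j + t else if l = i then k i - t else k l := by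
  simp only [cpt, Pi.add_apply, Pi.sub_apply, smul_e_apply]
  by_cases hlj : l = j
  · subst hlj; simp [hij.symm]
  · by_cases hli : l = i
    · subst hli; simp [hij]
    · simp [hlj, hli]

/-- The representative has `x_j`-exponent `0`. [folklore] -/
@[simp] theorem ckey_apply_right (hij : i ≠ j) (b : Fin n → ℕ) : ckey i j b j = 0 := by
  simp [ckey_apply hij]

/-- The representative carries the whole `x_i`- and `x_j`-exponent on `x_i`. [folklore] -/
@[simp] theorem ckey_apply_left (hij : i ≠ j) (b : Fin n → ℕ) : ckey i j b i = b i + b j := by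
  simp [ckey_apply hij, hij]

/-- The `x_j`-exponent of the line point `cpt i j k t`. [folklore] -/
@[simp] theorem cpt_apply_right (hij : i ≠ j) (k : Fin n → ℕ) (t : ℕ) : cpt i j k t j = k j + t := by
  simp [cpt_apply hij]

/-- A monomial is the point of its own line at its own position. [folklore] -/
theorem cpt_ckey (hij : i ≠ j) (b : Fin n → ℕ) : cpt i j (ckey i j b) (b j) = b := by
  ext l
  rw [cpt_apply hij, ckey_apply hij, ckey_apply hij, ckey_apply hij]
  by_cases hlj : l = j
  · subst hlj; simp
  · by_cases hli : l = i
    · subst hli; simp [hij]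
    · simp [hlj, hli]

/-- The representative of the line through `cpt i j k t` is `k`. [folklore] -/
theorem ckey_cpt (hij : i ≠ j) {k : Fin n → ℕ} (hk : k j = 0) {t : ℕ} (ht : t ≤ k i) :
    ckey i j (cpt i j k t) = k := by
  ext l
  rw [ckey_apply hij, cpt_apply hij, cpt_apply hij, cpt_apply hij]
  by_cases hlj : l = j
  · subst hlj; simp [hk]
  · by_cases hli : l = i
    · subst hli; simp [hij, hk]; omega
    · simp [hlj, hli]

/-- A member of the line with representative `k` is determined by its position. [folklore] -/
theorem eq_cpt_of_ckey_eq (hij : i ≠ j) {b k : Fin n → ℕ} (h : ckey i j b = k) : b = cpt i j k (b j) := by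
  rw [← h, cpt_ckey hij]

/-- The position of `b` on its line is at most the `x_i`-exponent of the representative. [folklore] -/
theorem le_ckey_left (hij : i ≠ j) (b : Fin n → ℕ) : b j ≤ ckey i j b i := by
  rw [ckey_apply_left hij]; omega

/-- Taking the line representative preserves the degree. [folklore] -/
theorem sum_ckey (hij : i ≠ j) (b : Fin n → ℕ) : ∑ l, ckey i j b l = ∑ l, b l := by
  rw [← Finset.add_sum_erase _ _ (mem_univ j), ← Finset.add_sum_erase _ _ (mem_erase.2 ⟨hij, mem_univ i⟩),
    ← Finset.add_sum_erase _ b (mem_univ j), ← Finset.add_sum_erase _ b (mem_erase.2 ⟨hij, mem_univ i⟩)]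
  have hrest : ∑ l ∈ (univ.erase j).erase i, ckey i j b l = ∑ l ∈ (univ.erase j).erase i, b l := by
    refine sum_congr rfl fun l hl => ?_
    rw [mem_erase, mem_erase] at hl
    rw [ckey_apply hij, if_neg hl.2.1, if_neg hl.1]
  rw [hrest, ckey_apply_right hij, ckey_apply_left hij]
  omega

/-- Points of a line have the degree of the representative. [folklore] -/
theorem sum_cpt (hij : i ≠ j) (k : Fin n → ℕ) {t : ℕ} (ht : t ≤ k i) : ∑ l, cpt i j k t l = ∑ l, k l := by
  rw [← Finset.add_sum_erase _ _ (mem_univ j), ← Finset.add_sum_erase _ _ (mem_erase.2 ⟨hij, mem_univ i⟩),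
    ← Finset.add_sum_erase _ k (mem_univ j), ← Finset.add_sum_erase _ k (mem_erase.2 ⟨hij, mem_univ i⟩)]
  have hrest : ∑ l ∈ (univ.erase j).erase i, cpt i j k t l = ∑ l ∈ (univ.erase j).erase i, k l := by
    refine sum_congr rfl fun l hl => ?_
    rw [mem_erase, mem_erase] at hl
    rw [cpt_apply hij, if_neg hl.2.1, if_neg hl.1]
  rw [hrest, cpt_apply_right hij, cpt_apply hij, if_neg hij, if_pos rfl]
  omega

/-- `ckey i j b ∈ Mon_d ↔ b ∈ Mon_d`. [folklore] -/
theorem ckey_mem_Mon_iff (hij : i ≠ j) {d : ℕ} {b : Fin n → ℕ} : ckey i j b ∈ Mon n d ↔ b ∈ Mon n d := by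
  rw [mem_Mon, mem_Mon, sum_ckey hij]

/-- Adding `e l`, `l ∉ {i, j}`, commutes with taking the line representative. [folklore] -/
theorem ckey_add_e_of_ne (hij : i ≠ j) (b : Fin n → ℕ) {l : Fin n} (hli : l ≠ i) (hlj : l ≠ j) :
    ckey i j (b + e l) = ckey i j b + e l := by
  ext r
  simp only [ckey_apply hij, Pi.add_apply, e_apply]
  by_cases hrj : r = j
  · subst hrj; simp [hlj.symm]
  · by_cases hri : r = i
    · subst hri; simp [hij, hli.symm, hlj.symm]
    · simp [hrj, hri]

/-- Multiplying by `x_i` shifts the line representative by `e i`. [folklore] -/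
theorem ckey_add_e_left (hij : i ≠ j) (b : Fin n → ℕ) : ckey i j (b + e i) = ckey i j b + e i := by
  ext r
  simp only [ckey_apply hij, Pi.add_apply, e_apply]
  by_cases hrj : r = j
  · subst hrj; simp [hij.symm]
  · by_cases hri : r = i
    · subst hri; simp [hij, hij.symm]; omega
    · simp [hrj, hri]

/-- Multiplying by `x_j` also shifts the line representative by `e i` (and the position by one). [folklore] -/
theorem ckey_add_e_right (hij : i ≠ j) (b : Fin n → ℕ) : ckey i j (b + e j) = ckey i j b + e i := by
  ext r
  simp only [ckey_apply hij, Pi.add_apply, e_apply]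
  by_cases hrj : r = j
  · subst hrj; simp [hij.symm]
  · by_cases hri : r = i
    · subst hri; simp [hij]; omega
    · simp [hrj, hri]

/-- The Borel move along the line: lowering the `x_j`-exponent by one. [folklore] -/
theorem sub_e_add_e_eq_cpt (hij : i ≠ j) {b : Fin n → ℕ} (hb : 0 < b j) :
    b - e j + e i = cpt i j (ckey i j b) (b j - 1) := by
  ext r
  simp only [cpt_apply hij, ckey_apply hij, Pi.add_apply, Pi.sub_apply, e_apply]
  by_cases hrj : r = j
  · subst hrj; simp [hij.symm]
  · by_cases hri : r = i
    · subst hri; simp [hij]; omega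
    · simp [hrj, hri]

/-- The set of `x_j`-exponents ("positions") of the members of `X` on the line with representative `k`. [folklore] -/
def pos (i j : Fin n) (X : Finset (Fin n → ℕ)) (k : Fin n → ℕ) : Finset ℕ :=
  (X.filter fun b => ckey i j b = k).image fun b => b j

/-- Membership in the position set of `X` on the line with representative `k`. [folklore] -/
theorem mem_pos (hij : i ≠ j) {X : Finset (Fin n → ℕ)} {k : Fin n → ℕ} {t : ℕ} :
    t ∈ pos i j X k ↔ cpt i j k t ∈ X ∧ k j = 0 ∧ t ≤ k i := by
  simp only [pos, mem_image, mem_filter]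
  constructor
  · rintro ⟨b, ⟨hb, hk⟩, rfl⟩
    refine ⟨?_, ?_, ?_⟩
    · rwa [← eq_cpt_of_ckey_eq hij hk]
    · rw [← hk]; exact ckey_apply_right hij b
    · rw [← hk]; exact le_ckey_left hij b
  · rintro ⟨hmem, hk, ht⟩
    exact ⟨cpt i j k t, ⟨hmem, ckey_cpt hij hk ht⟩, by simp [cpt_apply_right hij, hk]⟩

/-- The position set of a line has the cardinality of the corresponding fibre of `X`. [folklore] -/
theorem card_pos_eq (hij : i ≠ j) (X : Finset (Fin n → ℕ)) (k : Fin n → ℕ) :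
    (pos i j X k).card = (X.filter fun b => ckey i j b = k).card := by
  rw [pos, card_image_of_injOn]
  intro b hb b' hb' h
  rw [mem_coe, mem_filter] at hb hb'
  simp only at h
  rw [eq_cpt_of_ckey_eq hij hb.2, eq_cpt_of_ckey_eq hij hb'.2, h]

/-- Positions on the line with representative `k` are at most `k i`. [folklore] -/
theorem pos_subset_range (hij : i ≠ j) (X : Finset (Fin n → ℕ)) (k : Fin n → ℕ) :
    pos i j X k ⊆ range (k i + 1) := by
  intro t ht
  rw [mem_pos hij] at ht
  rw [mem_range]; omega

/-- Counting a family line by line. [folklore] -/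
theorem card_eq_sum_card_pos (hij : i ≠ j) {X : Finset (Fin n → ℕ)} {K : Finset (Fin n → ℕ)}
    (hK : ∀ b ∈ X, ckey i j b ∈ K) : X.card = ∑ k ∈ K, (pos i j X k).card := by
  rw [card_eq_sum_card_fiberwise (f := ckey i j) (t := K) (fun b hb => Finset.mem_coe.2 (hK b hb))]
  exact sum_congr rfl fun k _ => (card_pos_eq hij X k).symm

/-- The `(i,j)`-compression of `A` inside `Mon n d`. [folklore] -/
def compress (i j : Fin n) (d : ℕ) (A : Finset (Fin n → ℕ)) : Finset (Fin n → ℕ) :=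
  (Mon n d).filter fun b => b j < (pos i j A (ckey i j b)).card

/-- The compression lives in `Mon n d`. [folklore] -/
theorem compress_subset_Mon (i j : Fin n) (d : ℕ) (A : Finset (Fin n → ℕ)) : compress i j d A ⊆ Mon n d :=
  filter_subset _ _

/-- Membership in the compression. [folklore] -/
theorem mem_compress {d : ℕ} {A : Finset (Fin n → ℕ)} {b : Fin n → ℕ} :
    b ∈ compress i j d A ↔ b ∈ Mon n d ∧ b j < (pos i j A (ckey i j b)).card := mem_filter

/-- The positions of the compressed family on a line of `Mon n d` form an initial segment of the
same size as before.
[folklore] -/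
theorem pos_compress (hij : i ≠ j) {d : ℕ} {A : Finset (Fin n → ℕ)} {k : Fin n → ℕ}
    (hk : k ∈ Mon n d) (hkj : k j = 0) : pos i j (compress i j d A) k = range (pos i j A k).card := by
  ext t
  rw [mem_pos hij, mem_range, mem_compress]
  constructor
  · rintro ⟨⟨-, hlt⟩, -, ht⟩
    rwa [ckey_cpt hij hkj ht, cpt_apply_right hij, hkj, zero_add] at hlt
  · intro ht
    have htk : t ≤ k i := by
      have := card_le_card (pos_subset_range hij A k)
      rw [card_range] at this; omega
    refine ⟨⟨?_, ?_⟩, hkj, htk⟩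
    · rw [mem_Mon, sum_cpt hij k htk, mem_Mon.1 hk]
    · rwa [ckey_cpt hij hkj htk, cpt_apply_right hij, hkj, zero_add]

/-- Lines not meeting `Mon n d` carry no positions. [folklore] -/
theorem pos_eq_empty_of_not (hij : i ≠ j) {d : ℕ} {X : Finset (Fin n → ℕ)} (hX : X ⊆ Mon n d)
    {k : Fin n → ℕ} (hk : ¬(k ∈ Mon n d ∧ k j = 0)) : pos i j X k = ∅ := by
  rw [eq_empty_iff_forall_notMem]
  intro t ht
  rw [mem_pos hij] at ht
  refine hk ⟨?_, ht.2.1⟩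
  rw [← ckey_cpt hij ht.2.1 ht.2.2, ckey_mem_Mon_iff hij]
  exact hX ht.1

/-- Compression preserves the cardinality. [folklore] -/
theorem card_compress (hij : i ≠ j) {d : ℕ} {A : Finset (Fin n → ℕ)} (hA : A ⊆ Mon n d) :
    (compress i j d A).card = A.card := by
  set K := (Mon n d).image (ckey i j) with hK
  have hmaps : ∀ X, X ⊆ Mon n d → ∀ b ∈ X, ckey i j b ∈ K :=
    fun X hX b hb => mem_image_of_mem _ (hX hb)
  rw [card_eq_sum_card_pos hij (hmaps _ (compress_subset_Mon i j d A)),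
    card_eq_sum_card_pos hij (hmaps _ hA)]
  refine sum_congr rfl fun k hk => ?_
  obtain ⟨b, hb, rfl⟩ := mem_image.1 hk
  rw [pos_compress hij ((ckey_mem_Mon_iff hij).2 hb) (ckey_apply_right hij b), card_range]

/-- The compressed family is `(i,j)`-compressed. [folklore] -/
theorem sub_add_mem_compress (hij : i ≠ j) {d : ℕ} {A : Finset (Fin n → ℕ)} {b : Fin n → ℕ}
    (hb : b ∈ compress i j d A) (hbj : 0 < b j) : b - e j + e i ∈ compress i j d A := by
  rw [mem_compress] at hb ⊢
  have hk : ckey i j (b - e j + e i) = ckey i j b := by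
    rw [sub_e_add_e_eq_cpt hij hbj, ckey_cpt hij (ckey_apply_right hij b)]
    have := le_ckey_left hij b; omega
  refine ⟨?_, ?_⟩
  · have hd : d = d - 1 + 1 := by
      have h1 := mem_Mon.1 hb.1
      have : b j ≤ ∑ l, b l := single_le_sum (f := b) (fun _ _ => Nat.zero_le _) (mem_univ j)
      omega
    have hb1 := hb.1
    rw [hd] at hb1 ⊢
    exact add_e_mem_Mon (sub_e_mem_Mon hb1 hbj) i
  · rw [hk]
    have : (b - e j + e i) j = b j - 1 := by simp [hij.symm]
    rw [this]; omega

end Compression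

section CompressionShadow

variable {i j : Fin n}

/-- Multiplying a line point by `x_l`, `l ∉ {i, j}`. [folklore] -/
theorem cpt_add_e_of_ne (hij : i ≠ j) (k : Fin n → ℕ) (t : ℕ) {l : Fin n} (hli : l ≠ i) (hlj : l ≠ j) :
    cpt i j (k + e l) t = cpt i j k t + e l := by
  ext r
  simp only [cpt_apply hij, Pi.add_apply, e_apply]
  by_cases hrj : r = j
  · subst hrj; simp [hlj.symm]
  · by_cases hri : r = i
    · subst hri; simp [hij, hli.symm]
    · simp [hrj, hri]

/-- Multiplying a line point by `x_i`. [folklore] -/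
theorem cpt_add_e_left (hij : i ≠ j) (k : Fin n → ℕ) {t : ℕ} (ht : t ≤ k i) :
    cpt i j (k + e i) t = cpt i j k t + e i := by
  ext r
  simp only [cpt_apply hij, Pi.add_apply, e_apply]
  by_cases hrj : r = j
  · subst hrj; simp [hij.symm]
  · by_cases hri : r = i
    · subst hri; simp [hij]; omega
    · simp [hrj, hri]

/-- Multiplying a line point by `x_j`. [folklore] -/
theorem cpt_add_e_left_succ (hij : i ≠ j) (k : Fin n → ℕ) (t : ℕ) :
    cpt i j (k + e i) (t + 1) = cpt i j k t + e j := by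
  ext r
  simp only [cpt_apply hij, Pi.add_apply, e_apply]
  by_cases hrj : r = j
  · subst hrj; simp [hij.symm]; omega
  · by_cases hri : r = i
    · subst hri; simp [hij]
    · simp [hrj, hri]

/-- Positions of `A` on a line reappear as positions of `∇A` on the line shifted by `e l`, `l ∉ {i,j}`. [folklore] -/
theorem pos_subset_pos_shadow_of_ne (hij : i ≠ j) (A : Finset (Fin n → ℕ)) (k : Fin n → ℕ) {l : Fin n}
    (hli : l ≠ i) (hlj : l ≠ j) : pos i j A k ⊆ pos i j (shadow A) (k + e l) := by
  intro t ht
  rw [mem_pos hij] at ht ⊢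
  obtain ⟨hmem, hkj, htk⟩ := ht
  refine ⟨?_, by simp [hlj.symm, hkj], by simp [hli.symm, htk]⟩
  rw [cpt_add_e_of_ne hij k t hli hlj]
  exact add_e_mem_shadow hmem l

/-- Positions of `A` on a line reappear as positions of `∇A` on the line shifted by `e i`. [folklore] -/
theorem pos_subset_pos_shadow_left (hij : i ≠ j) (A : Finset (Fin n → ℕ)) (k : Fin n → ℕ) :
    pos i j A k ⊆ pos i j (shadow A) (k + e i) := by
  intro t ht
  rw [mem_pos hij] at ht ⊢
  obtain ⟨hmem, hkj, htk⟩ := ht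
  refine ⟨?_, by simp [hij.symm, hkj], by simp; omega⟩
  rw [cpt_add_e_left hij k htk]
  exact add_e_mem_shadow hmem i

/-- Positions of `A`, moved up by one, are positions of `∇A` on the line shifted by `e i` (multiplication by `x_j`). [folklore] -/
theorem image_succ_pos_subset_pos_shadow (hij : i ≠ j) (A : Finset (Fin n → ℕ)) (k : Fin n → ℕ) :
    (pos i j A k).image (· + 1) ⊆ pos i j (shadow A) (k + e i) := by
  intro t' ht'
  obtain ⟨t, ht, rfl⟩ := mem_image.1 ht'
  rw [mem_pos hij] at ht ⊢
  obtain ⟨hmem, hkj, htk⟩ := ht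
  refine ⟨?_, by simp [hij.symm, hkj], by simp; omega⟩
  rw [cpt_add_e_left_succ hij k t]
  exact add_e_mem_shadow hmem j

/-- A nonempty finite `P ⊆ ℕ` together with `P + 1` has at least `|P| + 1` elements. [folklore] -/
theorem card_union_image_succ {P : Finset ℕ} (hP : P.Nonempty) :
    P.card + 1 ≤ (P ∪ P.image (· + 1)).card := by
  have hmin : P.min' hP ∉ P.image (· + 1) := by
    intro h
    obtain ⟨p, hp, hp'⟩ := mem_image.1 h
    have := P.min'_le p hp
    omega
  calc P.card + 1 = (P.image (· + 1)).card + 1 := by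
        rw [card_image_of_injective _ (fun a b (h : a + 1 = b + 1) => by omega)]
    _ = (insert (P.min' hP) (P.image (· + 1))).card := (card_insert_of_notMem hmin).symm
    _ ≤ (P ∪ P.image (· + 1)).card :=
        card_le_card (insert_subset (mem_union_left _ (P.min'_mem hP)) subset_union_right)

/-- Line by line, the shadow of the compressed family occupies an initial segment of positions no
longer than the number of positions occupied by the shadow of the original family.
[folklore] -/
theorem pos_shadow_compress_subset (hij : i ≠ j) {d : ℕ} (A : Finset (Fin n → ℕ)) (k' : Fin n → ℕ) :
    pos i j (shadow (compress i j d A)) k' ⊆ range (pos i j (shadow A) k').card := by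
  intro t ht
  rw [mem_range]
  rw [mem_pos hij] at ht
  obtain ⟨hmem, hk'j, htk'⟩ := ht
  obtain ⟨b, hb, l, hbl⟩ := mem_shadow.1 hmem
  rw [mem_compress] at hb
  have hk' : k' = ckey i j (b + e l) := by rw [← hbl, ckey_cpt hij hk'j htk']
  have ht : t = (b + e l) j := by rw [← hbl, cpt_apply_right hij, hk'j, zero_add]
  by_cases hli : l = i
  · subst hli
    rw [ckey_add_e_left hij] at hk'
    have ht' : t = b j := by simp [ht, hij.symm]
    rw [hk', ht']
    exact hb.2.trans_le (card_le_card (pos_subset_pos_shadow_left hij A _))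
  · by_cases hlj : l = j
    · subst hlj
      rw [ckey_add_e_right hij] at hk'
      have ht' : t = b l + 1 := by simp [ht]
      rw [hk', ht']
      have hne : (pos i l A (ckey i l b)).Nonempty := card_pos.1 (by have := hb.2; omega)
      calc b l + 1 < (pos i l A (ckey i l b)).card + 1 := by have := hb.2; omega
        _ ≤ (pos i l A (ckey i l b) ∪ (pos i l A (ckey i l b)).image (· + 1)).card :=
            card_union_image_succ hne
        _ ≤ _ := card_le_card (union_subset (pos_subset_pos_shadow_left hij A _)
            (image_succ_pos_subset_pos_shadow hij A _))
    · rw [ckey_add_e_of_ne hij b hli hlj] at hk'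
      have ht' : t = b j := by simp [ht, Ne.symm hlj]
      rw [hk', ht']
      exact hb.2.trans_le (card_le_card (pos_subset_pos_shadow_of_ne hij A _ hli hlj))

/-- Compression does not increase the upper shadow. [folklore] -/
theorem card_shadow_compress_le (hij : i ≠ j) {d : ℕ} {A : Finset (Fin n → ℕ)} (hA : A ⊆ Mon n d) :
    (shadow (compress i j d A)).card ≤ (shadow A).card := by
  set K' := (Mon n (d + 1)).image (ckey i j)
  have hmaps : ∀ X, X ⊆ Mon n d → ∀ m ∈ shadow X, ckey i j m ∈ K' :=
    fun X hX m hm => mem_image_of_mem _ (shadow_subset_Mon hX hm)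
  rw [card_eq_sum_card_pos hij (hmaps _ (compress_subset_Mon i j d A)),
    card_eq_sum_card_pos hij (hmaps _ hA)]
  refine sum_le_sum fun k' _ => ?_
  simpa using card_le_card (pos_shadow_compress_subset hij (d := d) A k')

end CompressionShadow

section CompressionPotential

variable {i j : Fin n}

/-- The weight `Σ_l l · b_l` of an exponent vector. [folklore] -/
def wt (b : Fin n → ℕ) : ℕ := ∑ l : Fin n, (l : ℕ) * b l

/-- The potential `Σ_{b ∈ A} wt b`; every nontrivial compression lowers it. [folklore] -/
def potential (A : Finset (Fin n → ℕ)) : ℕ := ∑ b ∈ A, wt b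

/-- The weight along a line grows linearly in the position, with slope `j - i`. [folklore] -/
theorem wt_cpt (hij : i < j) (k : Fin n → ℕ) {t : ℕ} (ht : t ≤ k i) :
    wt (cpt i j k t) = wt k + ((j : ℕ) - i) * t := by
  have hne : i ≠ j := hij.ne
  unfold wt
  rw [← add_sum_erase _ _ (mem_univ j), ← add_sum_erase _ _ (mem_erase.2 ⟨hne, mem_univ i⟩),
    ← add_sum_erase _ (fun l : Fin n => (l : ℕ) * k l) (mem_univ j),
    ← add_sum_erase _ (fun l : Fin n => (l : ℕ) * k l) (mem_erase.2 ⟨hne, mem_univ i⟩)]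
  have hrest : ∑ l ∈ (univ.erase j).erase i, (l : ℕ) * cpt i j k t l =
      ∑ l ∈ (univ.erase j).erase i, (l : ℕ) * k l := by
    refine sum_congr rfl fun l hl => ?_
    rw [mem_erase, mem_erase] at hl
    rw [cpt_apply hne, if_neg hl.2.1, if_neg hl.1]
  rw [hrest, cpt_apply_right hne, cpt_apply hne, if_neg hne, if_pos rfl]
  have h1 : (i : ℕ) * (k i - t) + i * t = i * k i := by rw [← mul_add, Nat.sub_add_cancel ht]
  have h2 : ((j : ℕ) - i) * t = j * t - i * t := Nat.sub_mul _ _ _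
  have h3 : (i : ℕ) * t ≤ j * t := Nat.mul_le_mul_right t (by exact_mod_cast hij.le)
  have h4 : (j : ℕ) * (k j + t) = j * k j + j * t := mul_add _ _ _
  generalize (i : ℕ) * (k i - t) = P1 at *
  generalize (i : ℕ) * t = P2 at *
  generalize (i : ℕ) * k i = P3 at *
  generalize (j : ℕ) * t = Q1 at *
  generalize (j : ℕ) * (k j + t) = Q2 at *
  generalize (j : ℕ) * k j = Q3 at *
  omega

/-- Sum over a line, reindexed by positions. [folklore] -/
theorem sum_fiber_eq_sum_pos (hij : i ≠ j) (X : Finset (Fin n → ℕ)) (k : Fin n → ℕ)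
    (f : (Fin n → ℕ) → ℕ) :
    ∑ b ∈ X.filter (fun b => ckey i j b = k), f b = ∑ t ∈ pos i j X k, f (cpt i j k t) := by
  rw [pos, sum_image]
  · refine sum_congr rfl fun b hb => ?_
    rw [mem_filter] at hb
    rw [← eq_cpt_of_ckey_eq hij hb.2]
  · intro b hb b' hb' h
    rw [mem_coe, mem_filter] at hb hb'
    simp only at h
    rw [eq_cpt_of_ckey_eq hij hb.2, eq_cpt_of_ckey_eq hij hb'.2, h]

/-- The potential computed line by line. [folklore] -/
theorem potential_eq_sum (hij : i ≠ j) {d : ℕ} {X : Finset (Fin n → ℕ)} (hX : X ⊆ Mon n d) :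
    potential X = ∑ k ∈ (Mon n d).image (ckey i j), ∑ t ∈ pos i j X k, wt (cpt i j k t) := by
  unfold potential
  rw [← sum_fiberwise_of_maps_to (g := ckey i j) (t := (Mon n d).image (ckey i j))
    (fun b hb => mem_image_of_mem _ (hX hb))]
  exact sum_congr rfl fun k _ => sum_fiber_eq_sum_pos hij X k wt

/-- The total weight of a set of positions on a line. [folklore] -/
theorem sum_wt_cpt (hij : i < j) (k : Fin n → ℕ) {P : Finset ℕ} (hP : P ⊆ range (k i + 1)) :
    ∑ t ∈ P, wt (cpt i j k t) = P.card * wt k + ((j : ℕ) - i) * ∑ t ∈ P, t := by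
  rw [mul_sum, ← sum_const_nat (fun _ _ => rfl), ← sum_add_distrib]
  refine sum_congr rfl fun t ht => ?_
  have := mem_range.1 (hP ht)
  exact wt_cpt hij k (by omega)

/-- Among `s`-subsets of `ℕ`, the initial segment has the least sum, uniquely. [folklore] -/
theorem sum_range_card_le (P : Finset ℕ) :
    ∑ t ∈ range P.card, t ≤ ∑ t ∈ P, t ∧ (∑ t ∈ range P.card, t = ∑ t ∈ P, t → P = range P.card) := by
  induction hs : P.card generalizing P with
  | zero => simp [card_eq_zero.1 hs]
  | succ s ih =>
    have hne : P.Nonempty := card_pos.1 (by omega)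
    set M := P.max' hne with hM
    have hMmem : M ∈ P := max'_mem P hne
    have hcardE : (P.erase M).card = s := by rw [card_erase_of_mem hMmem]; omega
    have hsub : P ⊆ range (M + 1) := fun t ht => mem_range.2 (Nat.lt_succ_of_le (le_max' P t ht))
    have hMs : s ≤ M := by have := card_le_card hsub; rw [card_range] at this; omega
    obtain ⟨ih1, ih2⟩ := ih (P.erase M) hcardE
    rw [sum_range_succ, ← add_sum_erase P (fun t => t) hMmem]
    refine ⟨by omega, fun heq => ?_⟩
    have hM' : M = s := by omega
    have hE : P.erase M = range s := ih2 (by omega)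
    rw [← insert_erase hMmem, hE, hM']
    exact (range_add_one (n := s)).symm

/-- A compression that moves something strictly lowers the potential. [folklore] -/
theorem potential_compress_lt (hij : i < j) {d : ℕ} {A : Finset (Fin n → ℕ)} (hA : A ⊆ Mon n d)
    {b : Fin n → ℕ} (hb : b ∈ A) (hbj : 0 < b j) (hnot : b - e j + e i ∉ A) :
    potential (compress i j d A) < potential A := by
  have hne : i ≠ j := hij.ne
  rw [potential_eq_sum hne (compress_subset_Mon i j d A), potential_eq_sum hne hA]
  have hkey : ∀ k ∈ (Mon n d).image (ckey i j), k ∈ Mon n d ∧ k j = 0 := by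
    intro k hk
    obtain ⟨c, hc, rfl⟩ := mem_image.1 hk
    exact ⟨(ckey_mem_Mon_iff hne).2 hc, ckey_apply_right hne c⟩
  -- termwise comparison
  have hle : ∀ k ∈ (Mon n d).image (ckey i j),
      ∑ t ∈ pos i j (compress i j d A) k, wt (cpt i j k t) ≤ ∑ t ∈ pos i j A k, wt (cpt i j k t) := by
    intro k hk
    obtain ⟨hkM, hkj⟩ := hkey k hk
    have hPA := pos_subset_range hne A k
    have hsA : (pos i j A k).card ≤ k i + 1 := by simpa using card_le_card hPA
    rw [pos_compress hne hkM hkj, sum_wt_cpt hij k hPA,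
      sum_wt_cpt hij k (range_subset_range.2 hsA), card_range]
    exact Nat.add_le_add_left (Nat.mul_le_mul_left _ (sum_range_card_le _).1) _
  -- strictness on the line of `b`
  have hk₀ : ckey i j b ∈ (Mon n d).image (ckey i j) := mem_image_of_mem _ (hA hb)
  refine sum_lt_sum hle ⟨ckey i j b, hk₀, ?_⟩
  obtain ⟨hkM, hkj⟩ := hkey _ hk₀
  have hPA := pos_subset_range hne A (ckey i j b)
  have hsA : (pos i j A (ckey i j b)).card ≤ ckey i j b i + 1 := by simpa using card_le_card hPA
  rw [pos_compress hne hkM hkj, sum_wt_cpt hij _ hPA,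
    sum_wt_cpt hij _ (range_subset_range.2 hsA), card_range]
  refine Nat.add_lt_add_left (Nat.mul_lt_mul_of_pos_left ?_ (by omega)) _
  refine lt_of_le_of_ne (sum_range_card_le _).1 fun heq => hnot ?_
  have hP : pos i j A (ckey i j b) = range (pos i j A (ckey i j b)).card := (sum_range_card_le _).2 heq
  -- `b j` is a position, hence so is `b j - 1`
  have hbpos : b j ∈ pos i j A (ckey i j b) :=
    (mem_pos hne).2 ⟨by rwa [cpt_ckey hne], hkj, le_ckey_left hne b⟩
  have hb1 : b j - 1 ∈ pos i j A (ckey i j b) := by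
    rw [hP, mem_range] at hbpos ⊢; omega
  rw [mem_pos hne] at hb1
  rw [sub_e_add_e_eq_cpt hne hbj]
  exact hb1.1

end CompressionPotential

/-- **Compression to a Borel set.** Every family of degree-`d` monomials can be replaced by a Borel
set of the same size with no larger upper shadow. [folklore] -/
theorem exists_isBorel_card_eq {d : ℕ} (A : Finset (Fin n → ℕ)) (hA : A ⊆ Mon n d) :
    ∃ B : Finset (Fin n → ℕ), IsBorel B ∧ B ⊆ Mon n d ∧ B.card = A.card ∧
      (shadow B).card ≤ (shadow A).card := by
  suffices h : ∀ (N : ℕ) (A : Finset (Fin n → ℕ)), potential A = N → A ⊆ Mon n d →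
      ∃ B : Finset (Fin n → ℕ), IsBorel B ∧ B ⊆ Mon n d ∧ B.card = A.card ∧
        (shadow B).card ≤ (shadow A).card from h _ A rfl hA
  intro N
  induction N using Nat.strong_induction_on with
  | _ N ih =>
    intro A hN hA
    by_cases hBorel : IsBorel A
    · exact ⟨A, hBorel, hA, rfl, le_rfl⟩
    · unfold IsBorel at hBorel
      push Not at hBorel
      obtain ⟨b, hb, i, j, hij, hbj, hnot⟩ := hBorel
      obtain ⟨B, hB, hBd, hcard, hsh⟩ := ih (potential (compress i j d A))
        (hN ▸ potential_compress_lt hij hA hb hbj hnot) (compress i j d A) rfl (compress_subset_Mon i j d A)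
      exact ⟨B, hB, hBd, hcard.trans (card_compress hij.ne hA),
        hsh.trans (card_shadow_compress_le hij.ne hA)⟩

/-- **Macaulay's theorem on lex segments (upper-shadow form).** Among all families of degree-`d`
monomials of at least a given size, a lex segment has the smallest upper shadow.
[cite: MillerSturmfels2005, Thm. 2.22] -/
theorem card_shadow_le_of_isLexSeg {d : ℕ} {L A : Finset (Fin n → ℕ)} (hL : IsLexSeg L d)
    (hA : A ⊆ Mon n d) (h : L.card ≤ A.card) : (shadow L).card ≤ (shadow A).card := by
  obtain ⟨B, hB, hBd, hcard, hsh⟩ := exists_isBorel_card_eq A hA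
  exact (card_shadow_le_of_isLexSeg_of_isBorel hL hB hBd (hcard ▸ h)).trans hsh

end Literature.RingTheory.MvPolynomial.Macaulay
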